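import Literature.MathematicalPhysics.QuantumFieldTheory.Balaban1983to89.DagBinding
import Literature.MathematicalPhysics.QuantumFieldTheory.Balaban1983to89.B1Eq324CumulantTaylor
import Literature.MathematicalPhysics.QuantumFieldTheory.Balaban1983to89.B2Sect3C
import Literature.MathematicalPhysics.QuantumFieldTheory.Balaban1983to89.B7Eq92Concrete
import Literature.MathematicalPhysics.QuantumFieldTheory.Balaban1983to89.B11Eq174Chart
import Literature.MathematicalPhysics.QuantumFieldTheory.Balaban1983to89.B11Eq81Expansion
import Literature.MathematicalPhysics.QuantumFieldTheory.Balaban1983to89.B9Eq3185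
import Literature.MathematicalPhysics.QuantumFieldTheory.Balaban1983to89.B10SectAStatements
import Literature.MathematicalPhysics.QuantumFieldTheory.Balaban1983to89.B10SectAGathering
import Literature.MathematicalPhysics.QuantumFieldTheory.Balaban1983to89.B10Eq35Norm

/-!
# `Balaban1985CMP102.Binders` — the results of the earlier papers that T. Bałaban, *Ultraviolet stability of
# three-dimensional lattice pure gauge field theories*, Commun. Math. Phys. **102** (1985) 255–275 [Balaban1985UV3]
# CITES, collected AS PRINTED for the lane `pub-balaban3d` (spine typer 2): one row per citation = (source, printed
# locus) · (where [B10] invokes it, page/line) · the tree declaration that types it — ALL RE-USED BY NAME (`export`),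
# none restated; this module is the lane's binder index (PLAN.md §1g, §2 Table A; SPINE-COVERAGE.md §B)

HONEST FRAMING (PLAN.md §0).  The lane formalizes [B10] modulo its printed inputs; each input is a HYPOTHESIS typed
as printed in the cited paper (a `…Printed`/`Leaf` decl of LQB = `Literature.MathematicalPhysics.QuantumFieldTheory.
Balaban1983to89`, the pub-balaban sub-cell tree, whose docstrings quote the source pages from renders) and consumed
by the lane's provers by name; nothing of the series is asserted here.  NOT a continuum limit, NOT infinite volume,
NOT a mass gap, NOT d = 4, NOT Clay.  [B10]'s own reference numbering (p. 274): [2] = B5 (CMP 95), [3] = B6 (CMP 96),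
[4] = B7 (CMP 98), [5] = B9 (CMP 99:389), [6] = B8 (CMP 99:75), [7] = B11 (CMP 102:277), [8] = B1 (CMP 85), [9] = B2
(CMP 86), [10] = B3 (CMP 88).  Journal page = PDF page + 254 for [B10]; line numbers «p. N Lm» count the
printed lines of the journal page from the top, DISPLAYS COUNTED AS LINES (a two-line display = two lines), running head
excluded — a text-only count (REFEREE F-8/F-21) is lower by the number of display lines above; this seat re-read every CITING sentence of
[B10] on the renders `…/b2b-balaban-ref1/pages/1985-cmp102-uv-stability-3d/` (quoted «…» below with page/line); the
CITED statements are quoted in the LQB declarations named (render-read by the LQB seats; not re-quoted here).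
d-STATUS (DEPMAP.md §7, PLAN §2.2 B-8): every binder below is d-PARAMETRIC or d-free in print and in LQB and is
instantiated verbatim at d = 3; b6 must be taken in PARAMETER form (`DagBinding.B6BlockParam`: the literal constant
c₁ of [B6] Lemma 2.1 is refuted for d ≥ 3, `B6Lemma21Counterexample`).

THE BINDER TABLE (row id of SPINE-COVERAGE.md §B · cited locus · [B10] citing sentence · tree decl(s)).
* B11-Thm1 · [7] Thm 1 p. 279 with (8)–(10) («The constants a₀, a₁, B₃ depend on d and L only») · p. 259 L1–4 «For g₀
  sufficiently small 2L²g₀p(g₀) < a₁, where a₁ is the constant in Theorem 1 [7], hence there exists the exactly one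
  critical configuration U₁ …»; (42) p. 266 L23–25 «the variational problem considered in [7]»; p. 268 L15–17 ·
  `B11.Thm1Printed`, faithful leaf `DagBinding.B11Leaf`, first-step instance `B10SectAStatements.Eq12`, nested step
  `B10NestedMinimizer.levelMin_of_thm1At`.
* B11-Prop2-26 · [7] Prop 2 p. 281, (26) p. 282 · p. 260 L36–38 «This expansion, with a special emphasis on linear and
  quadratic terms, was described in [7], Eq. (26)»; p. 269 L1 «the expansion (26)» · `B11.Prop2Printed` (hypothesis-level,
  d-free — THE binder at d = 3); the concrete lineage `B11Eq26ActionExpansion`/`B11Eq26FirstVariation` (over `B9Eq39Adjoint.action`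
  with the ℕ-exponent η^{d−4}) is d ≥ 4 ONLY (every content theorem carries `4 ≤ d`; lane DEPMAP.md §9 finding N8) and is NOT a
  d = 3 input; the B10-side shapes `B10Eq19LinearTerm.hasFDerivAt_of_expansion26`, `B10SectCExpansion.Line2_53` are d-free.
* B11-Prop4 · [7] Prop 4 (97)–(98) pp. 292–293 (regularity of the minimiser) · p. 259 L7, p. 267 L1 «The configuration
  U_k satisfies the following regularity condition on Ω_k: |U_k(∂p) − 1| < 2L²B₃g_{k−1}p(g_{k−1})η²» · `B11.Prop4Printed`.
* B11-Prop7 / B11-SectF-158 · [7] Prop 7 p. 299, Sect. F p. 300, (158) p. 302 · p. 263 L15–20 «We apply the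
  constructions and results of Sect. F [7]. According to these there exists a gauge transformation … such that the
  gauge transformed U₁ is represented as exp i𝓗(B) … 𝓗(B) = HB + A₁, where … A₁ is a non-linear perturbation
  determined by Eq. (158) [7]»; p. 270 L37–p. 271 L2 «We use results of Sect. F [7], and we construct the representation
  U_{k+1} = exp iη𝓗(B)» · `B11.Prop7Printed`, `B11.SectFPrinted`, `B11SectFAssembly`, `B11SectFCoverage`.
* B11-SectG-174-175 / B11-Prop9 · [7] Sect. G (174)–(175) p. 305, Prop 9 p. 309 · (52) p. 268 L35–37 «Using the results
  of Sect. G [7] we write (52) … where 𝓗(B) is determined by Eqs. (174), (175) [7]» · `B11Eq174Chart.chartH`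
  (+ `Regime.chartH_eq174`, `Regime.eq175`), `B11.Prop9Printed`, `B11SectG`.
* B11-74 / B11-78-81 (PLAN §1g lists them under [4]; the print says «of [7]») · [7] (74), (78)–(81) pp. 289–290 ·
  p. 269 L1 «the action, the expansion (26), Eq. (174), and the formulas (74), (78)–(81) of [7], we get (53)» ·
  `B11Eq81Expansion.functional74`, `B11Eq81Expansion.V80`, `B11Eq81Expansion.IsCritical82`; consumer
  `B10SectCExpansion.Line2_53`/`Expansion53`.
* B7-Prop1-50-53 · [4] Prop 1 p. 26 with (50) p. 25, (53) p. 26 · p. 258 L31–33 «by Proposition 1 from [4] the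
  configuration V = Ū satisfies the conditions |V(∂p′) − 1| < 2L²g₀p(g₀) on Ω₀^{(1)}»; (69) p. 273 L14 «Applying the
  inequalities (50), (53) [4], we have (69)» · `B7.Prop1Printed`, `B7Prop1Explicit`, `B7Eq50Linear`,
  `B10.edge_B7Prop1_twoLsq`, (69) knit `B10Eq69Concrete`.
* B7-63 / B7-89 · [4] (63) p. 28, (89) p. 31 · (14) p. 259 L26–28 «where the second equality follows from the definition
  (89) (or (63)) in [4], and the gauge fixing conditions»; (50) p. 268 L26–29 · `B7Eq92Concrete.tild` ((65)),
  `B7Eq92Concrete.dbavgCov` ((89)), `B7Eq92Concrete.tild_eq_frame_dbavgCov` ((63)/(92)); display `SectC.Eq50` of this lane.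
* B7-124-Prop3 · [4] (124) + Prop 3 p. 36 · p. 259 L28–31 «Properties of the function Q(A′) = Q(U₁, A′) were described in
  Proposition 3 [4]. It is an analytic function of A with the decomposition (15) Q(A′) = QA′ + C(A′), where Q = Q(U₁) is
  the linear averaging operator defined by (124) [4]»; p. 260 L12 «inspecting the formula (124) [4] for Q»; p. 271 L30–32
  «a linear operator S(V^{(k)}, b₀(c)) acting on the Lie algebra 𝔤, see the formula (124) [4]» · `B7.Prop3Printed`,
  `B7Prop3Flat`, `B7Prop3GeneralAnalytic.analyticAt_mlog_dbavgCov_expCfg`, `B7Prop3GeneralLinear`, `B7.Concl`.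
* B8-Lemma1 · [6] Lemma 1 p. 79 (α₀, α₁) · p. 259 L8–11 «U₁, U′U₁ satisfy the assumptions of Lemma 1 [6] with α₀ =
  2L²B₃g₀p(g₀), α₁ = 0, and the lemma yields the bound |U′ − 1| < 8·3²L²B₃g₀p(g₀)»; p. 268 L19–20 «|V′_k − 1| <
  16·3²L²B₃g_kp(g_k)» · `B8.Lemma1Printed`, faithful leaf `DagBinding.B8LeafR`, knits `B10.edge_B8Lemma1_alpha1_zero`,
  `B10Eq13RegularityClaims.claim259`/`claim268`, `B8Lemma1Lattice`/`B8Lemma1NonAbelian`.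
* B8-SectE · [6] Sect. E p. 95 «A Construction of the Linearizing Transformation» (PDF 21 of
  `paper:balaban1985-cmp99-regular-spaces-gauge-fixing`, section heading re-read by this seat) · p. 260 L7–8 «We have
  analyzed the equations of the type (17) several times already, see Sect. E in [6], Sect. C in [7]» (NOT the gauge
  fixing (9), pace PLAN §1g) · hypothesis-shaped `B10SectAStatements.Eq17`; no separate LQB decl of [6] Sect. E.
* B9-Thm310 / B9-3108 · [5] Thm 3.10 p. 415, (3.107)–(3.108) pp. 415–416 · p. 262 L8–12 «we expand the propagators
  C^{(0)}(Ω₁, U₁) into the generalized random walk expansion described in [5], Theorem 3.15, Theorem 3.10 and the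
  preceding theorems»; (23) p. 262 L16–19 «satisfies the bound (3.108) [5], i.e. can be bounded by (23)» ·
  `B9.Thm310Printed`, `B9.Thm37_39_310Printed`, faithful leaf `DagBinding.B9LeafX`; (23) knit `B10Eq25Rate`.
* B9-SectE / B9-3155-3156 · [5] Sect. E p. 427, (3.155)–(3.156) pp. 427–428 · (54) p. 269 L6–8 «where Δ_k was defined by
  (3.156) in [5], and investigated in Sect. E of that paper. … using the definition (3.155) [5]»; p. 271 L26–28 «the
  independent variables Ã introduced at the beginning of Sect. E [5]. They are connected with A by the simple linear
  operator C described there, A = CÃ» · `B9SectECov.eq_3157`, `B9SectECov.eq_3157_flucCov`, `B9SectEKernel`,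
  `B9Eq3112`; consumer `B10SectCExpansion.QuadForm54`.
* B9-3183 / B9-3185 / B9-Thm315 · [5] (3.183), (3.185), Thm 3.15 p. 432 · p. 272 L9–16 «the operator C(C*Δ_kC + xI)^{−1}C*
  is represented by the integral (3.183) [5] with the additional term … The integral yields the representation analogous
  to (3.185)»; p. 262 L12 «Theorem 3.15» · `B9Eq3183.kappaFP`, `B9Eq3185.K3183`, `B9.Thm315Printed`,
  `B9.Thm315FullPrinted`, `B9Thm315Decay`; consumer `B10Eq63Rep.G3Rep`, `B10LogDet63`.
* B5-Props / B6-Block · [2] Props 1.1–1.2 pp. 33–36, [3] Lemma 2.1–Prop 2.7 pp. 234–249 · p. 255 (Introduction) «the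
  results of [2]–[7]», and through [5] inside (22), (55) · `B5.MainBlock`, `DagBinding.B6BlockParam` (parameter form).
* B1-324 · [8] CMP 85 (3.24) p. 616 · p. 262 L1–3 «Next, the integral is calculated by the cumulant expansion formula
  (3.24) [8], again up to the sixth order in g₀» · `B1Sect3Statements.Eq324` (as printed), DISCHARGED from named
  smallness inputs `B1Eq324CumulantTaylor.eq324_of_truncated_bound` (candidate outright proof, PLAN §2.1).
* B2-3C · [9] CMP 86 Sect. 3.C p. 592 «The Combinatorial Estimate» · p. 273 L32–p. 274 L2 «The analysis of Sect. 3.C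
  [9], which is model independent, show that these small factors are enough to control all sums in (41)» ·
  `B2.Claim342Printed` (with `B2.Params`, `B2.Run`), arithmetic `B2Sect3C` (`Leaf347`, …); consumer
  `B10.LargeFieldControlPrinted`, `B10LargeFieldSum.largeFieldControl_of_resummation`.
* B10-ref1 · [1] Bałaban, Physica 124A (1984) · (2) p. 256 L11 «the renormalization transformations T described in
  [1, 4]» · survey, not load-bearing; no decl.
* G3D-01 (lane GAP row, PLAN §2.5 v1.3 — an input [B10] USES with no value printed and no cited locus printing one) ·
  «previous papers» (p. 263 L5–6, unnumbered) for the analyticity of 𝒫′₁(g₀, X, ·) in U₁, [7] Sect. F (158) p. 302 /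
  Sect. G Prop 9 p. 309 for the chart U₁ = exp i𝓗(B) · consumed at (29)–(30) p. 263, p. 264 L12–15, p. 271 L1–4 (⇒ (33),
  (60)) · NEW hypothesis-shaped `ChartAnalyticityAsCited Ψ ρ M` (§3: the radius ρ and the bound M are explicit
  parameters), certified load-bearing by `ChartAnalyticityAsCited.remainder30` := LQB `B10SectAGathering.taylor7_remainder_le`
  (pub-balaban cell GAPS G-B10-04).
* G3D-02 (lane GAP row, lead-g2 2026-08-22T00:04:18Z; p5 G-p5-1) · [B10] p. 262 L1–28 (PROSE: the sixth-order cumulant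
  calculation «can be represented by lower order connected vacuum graphs … at most eight legs … at most six vertices»,
  lines ↦ random walks of [5] Thms 3.10/3.15, per-term bound (23) = (3.108) [5] pp. 415–416, localization X, «Summing
  the expressions with the same localization X we get finally the inequality (24)»; k-th step p. 270) · the graph
  expansion is constructed nowhere in print/LQB (cell GAPS G-IF-04) · NEW carrier `GraphTerms D Cfg` (data) +
  hypothesis-shaped `GraphRep23AsCited G cum C c M₁ δ₀` (§3; (23)'s factor = LQB `B9.walkFactor` BY NAME, one per line),
  with `GraphTerms.activities : B10.PolymerActivities` (so rows (24)/(25) stay RE-USE: `B10Eq24Cumulant`,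
  `B10.Bound25Printed`) and the kernel-checked regrouping `GraphRep23AsCited.cum_eq_sum_activities`, `abs_act_le`.
* G3D-04 (lane GAP row, lead-g2 batch 4 (2/3); p6 (B)) · [B10] (35) p. 265 asserted at k = 0; its k-th-step analogue used
  silently between (61) and (62) p. 271, NOT IN PRINT (cell GAPS G-B10-07 (a)) · NEW hypothesis-shaped `Norm35StepAsCited P c a cv cJ
  := ∀ h, Nonempty (B10Eq35Norm.Norm35Model P c a cv cJ h)` (LQB model data BY NAME) + `Norm35StepAsCited.norm35` (:= LQB
  `norm35_of_model`) → leaf `Norm35`, LEAF-LEDGER C8.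
* G3D-05 (lane GAP row, lead-g2 batch 4 (2/3); p6 (B)) · «log Z^{(k)}(T₁^{(k)}, 1) extensive», implicit in (65) p. 273, Z^{(k)}
  described p. 271 L20–28 / p. 272 L1–2 only (cell GAPS G-B10-03) · NEW model-data carrier `LogZTModel P c a cn cJ` (drafted by
  p6, vendored here) + `abs_log_gaussian_le`, `LogZTModel.logZT_le` (kernel-checked) + hypothesis-shaped `LogZTExtensiveAsCited
  := Nonempty (LogZTModel …)` + `.logZT_le` → `LeafSystem.logZT_le`, LEAF-LEDGER B20.
* G3D-06 (lane GAP row, lead-g2 batch 5 (1/2); p6 C5/C7) · [B10] p. 264 L14–20, p. 271 L6–8 (PROSE, justified by propagator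
  decay [5] (3.108)) · NEW hypothesis-shaped `FarTermsDecayAsCited far M Cfar c := ∀ X h U, |far X h U| ≤ Cfar·(M X·c)` (p6's
  per-domain shape) + `FarTermsDecayAsCited.abs_sum_le`.
* G3D-07 (lane GAP row, lead-g4 batch 14 (1/3) R-G7, 2026-08-22T01:28:25Z, text field-checked R-G7′/R-G7″; p6 C7) · [B10]
  p. 271 L19–35, (63) p. 272 L4–25, k = 0 p. 265 L13–16 (PROSE + CITATION: «It can be localized in a similar way, although a bit
  more complicated, as the perturbative expressions … simple, local, gauge invariant functions … Its logarithm is equal to a sum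
  of an absolute constant, cancelled by the same constant from the second term in (61), and the expression (63) … This gives an
  expansion for the sum above into gauge invariant, localized expressions, with proper exponential decay properties. These are
  analyzed further in the same way as the perturbative terms … They are again analyzed in the way described before … This is
  cancelled by the second term in (61), and we obtain the desired expansion», citing [5] (3.156), (3.183), (3.185), Thm 3.15 =
  rows B9-3155-3156 / B9-3183 / B9-3185 / B9-Thm315 and [4] (124) = row B7-124-Prop3) · the operator-level half is
  KERNEL-CHECKED in LQB and NOT restated (`B10LogDet63.matrix63`, `hasSum_matrix63`, `matrix63_of_form_le`, `diff61_split`,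
  `log_gaussian_diff61`, `logHalfBound_of_walks`, `logHalfBound_integral63`, `sum_Elog_eq`; its one unprinted input typed there
  as `B10LogDet63.G3WalkBound`, cell GAPS G-B10-06/G-IF-10) · NEW at the chart level: hypothesis-shaped structure
  `LogZLocalizedAsCited T k E π ρ r₀ Cfar C63 κ logZU logZ1 Bcfg dom` (§3; data `Ψ`, `far` + Props `expandDiff` = only the
  DIFFERENCE (61) localized, `chart` = G3D-01 BY NAME at a g-free amplitude, `inv26` = «gauge invariant» over an explicit
  action, `far_le` = G3D-06 BY NAME; drafted Summits-side by p6 as `LogZLocalization` (handoff text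
  ForTyper2_G3D07.lean 18926e5b, referee pre-countersign F-46), vendored here, no twin) + bookkeeping `amplitude_nonneg`,
  `abs_re_sub_re_le`, `abs_diff61_le`, `abs_sum_far_le` → leaf `Decomp35_61`, LEAF-LEDGER C7.

SOURCE PAGES RE-READ BY THIS SEAT (renders `…/b2b-balaban-ref1/pages/<paper>/…-p0NN-x2.png` read as images, 2026-08-21;
[B8] from the text layer `paper:balaban1985-cmp99-regular-spaces-gauge-fixing` p0005/p0021, no render on disk), confirming
that the LQB declarations named above type the CITED statements and that every one is d-PARAMETRIC in print:
[7] p. 279 Thm 1 with (8)–(10) «The constants a₀, a₁, B₃, depend on d and L only»; p. 289–290 (74) «𝔉(A′) = A(U₀) +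
⟨A′ − HD(A′), J⟩ + ½⟨A′ − HD(A′), Δ_π(A′ − HD(A′))⟩ + V₀(A′ − HD(A′))», (78) «⟨HD(A′), J⟩ = ⟨HC^{(2)}(A′), J⟩ + ⟨HD₃(A′), J⟩»,
(79), (80) «V(A′) = −⟨HD₃(A′), J⟩ − ⟨A′, Δ_πHD(A′)⟩ + ½⟨HD(A′), Δ_πHD(A′)⟩ + V₀(A′ − HD(A′))», (81) «𝔉(A′) = A(U₀) + ⟨A′, J⟩ +
½⟨A′, Δ₁A′⟩ + V(A′)» (the three members of [B10] (53)); pp. 292–293 Prop 4 with (97)–(98) «The constants a₃, C₄ depend on d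
and L only» and p. 293 «the identity ⟨δA′, Δ₁H₁B⟩ = 0 following from the definitions of H₁» (the orthogonality relation of [B10]
(53)); p. 299 Prop 7 «There exist positive, absolute constants a₀, a′₁ such that for ε₀ ≤ a₀ and B₃ε₁ ≤ ε₀ the variational problem
(5), (6) has at most one critical orbit …»; p. 302 (158) «A₁ + G̃((δ/δA′)V)(A₁ + HB) = 0» with «we can take C₁ = L³»; p. 305 (174) «𝓗 = 𝒜₁ + H₁B − HD(𝒜₁ + H₁B)», (175) «𝒜₁ +
𝔊((δ/δA′)V)(𝒜₁ + H₁B) = 0»; p. 309 Prop 9 «The function U_k(V′V₀)U_k(V₀)^{−1} transformed to the Landau gauge is, by the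
definition, equal to exp iη𝓗(B), where B = 1/i log V′. The function 𝓗(B) is determined by Eqs. (174), (175), or (179), (180).»
(= [B10] (52) with V′ = exp i(A − D̃(A)), U_k(V₀) = U_{k+1}).  [4] p. 25 (50) «|V̄₀(∂p′) − 1| < Σ_{x∈B(y₀)} L^{−d} Σ_{p⊂(p′)_x}
|V₀(∂p) − 1| + O(1)(L²α₀)² < L²α₀ + O(1)(L²α₀)²», p. 26 Prop 1 (51) «|V̄(∂p′) − 1| < L²α₀ + C₀(L²α₀)². The constant C₀ depends on
d and c′₂ depends on d and L», (53) (the j-fold iterate) — the L^{−3j} block average of [B10] (69) is (50)+(53) at d = 3;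
p. 28 (63), p. 31 (89) «(\overline{\overline{R(V₀)V₁}})_c = (\overline{R_{0,c₋}V₁})^{−1}(\overline{V₁V₀})_c(V̄₀)_c^{−1}R̄_{0,c}
\overline{R_{0,c₊}V₁}», (92); p. 36 (121) «Q(V₀, A, c) = (1/i) log(V̿₁)_c», (122) «Q(V₀, A, c) = L(Q(V₀)A)_c + C(V₀, A, c)»,
(124) (the linear form), Prop 3 «The constant C₁ depends on d and c₃ depends on d and L».  [6] p. 79 Lemma 1 (1.24)–(1.25)
«|V′ − 1| < 4d²α₀ + α₁ on Ω₁» (4d²·2L²B₃g₀p(g₀) = 8·3²L²B₃g₀p(g₀) at d = 3 = [B10] p. 259 L11); p. 95 Sect. E heading «A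
Construction of the Linearizing Transformation».  [5] p. 415–416 Thm 3.10 with (3.107)–(3.108) «The constant O(1) depends on
d and L only» (= [B10] (23)); p. 427–428 (3.155) (the unit-lattice covariance C^{(k)}(Λ) as a Gaussian integral with
δ(Q₁B)δ_{Ax}(B)), (3.156) «⟨B, (QG₁Q*)^{−1}B⟩ − a⟨B, B⟩ − 2⟨H₁D̃^{(2)}(B), J⟩ = ⟨B, Δ_kB⟩», «B = CB̃, where C is a linear
operator … almost local», (3.157)–(3.158), «C*Δ_kC with a lower bound γ₀ > 0 independent of k and U»; p. 432 (3.183)–(3.185)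
«C^{(k)}(Λ) = (I + D̄μ)QG̃₂Q*(I + μ*D̄*)», Thm 3.15 (3.187) «B₀, δ₀ depending on d and L only».  [8] p. 616 (3.24) «⟨χ exp(V)⟩
= exp[⟨V⟩ + (1/2!)⟨V²⟩^T + … + (1/n̄!)⟨V^{n̄}⟩^T + O(ε^κ)|T₁|], κ > d».  [9] p. 592 (3.42) and «C. The Combinatorial Estimate.
In this section we will prove the inequality (3.42). The proof is purely combinatoric and model-independent.», (3.44)–(3.45)
«|𝒞_k| ≤ 3^d(|P_v^{(k)}| + … + |R_s^{(k)}|)».  Full transcriptions: lane HOME `LIT-STATUS.md` (typer-2 section) and the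
seat's NOTES.
[cite: Balaban1985UV3, References p.274; pp.258–273 as listed]
-/

namespace Literature.MathematicalPhysics.QuantumFieldTheory.Balaban1985CMP102.Binders

open Literature.MathematicalPhysics.QuantumFieldTheory.Balaban1983to89
open Literature.MathematicalPhysics.QuantumFieldTheory.Balaban1983to89.DagBinding

/-! ## §1 The lane's series inputs as ONE proposition (PLAN §2.3) -/

/-- **The series part of the lane's input list** (PLAN.md §2.3: «Lane inputs = {b5, b6(param), b7, b8 (= B8LeafR), b9,
b11} ∪ {[B1](3.24) unless proved, [B2]§3.C}») over the printed carriers of LQB's `DagBinding` — EXACTLY the six in-edges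
of B10 in the 4D DAG `Dag.B10_main : b5 → b6 → b7 → b8 → b9 → b11 → b10` (Dag.lean) in the FAITHFUL bindings of
`DagBinding.Upstream.ofPrintedAllXP`: b5 = `B5.MainBlock` ([2] Props 1.1–1.2), b6 = `B6BlockParam` ([3] in parameter
form — mandatory at d = 3, the literal c₁ of Lemma 2.1 being refuted for d ≥ 3), b7 = `B7.Concl` ([4] Props 1–10), b8 =
`B8LeafR` ([6] Lemma 1 … Thm 8 in the Sect. G/H typing), b9 = `B9LeafX` ([5] Thms 3.1–3.15), b11 = `B11Leaf` ([7] Thm 1,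
Props 2–9).  A conjunction of hypotheses BY NAME (`seriesInputs_iff`), never asserted; the lane's end theorem (PLAN §0.5
E4) takes it — instantiated at d = 3 carriers — plus the two non-series inputs `B1Sect3Statements.Eq324`,
`B2.Claim342Printed`. [cite: Balaban1985UV3, References [2]–[7] p.274] -/
def SeriesInputs (X : PrintedCarriersR) (Y : PrintedCarriers9X) (Z : PrintedCarriers11) : Prop :=
  B5.MainBlock X.fam5 X.forms5 ∧ B6BlockParam X.D6 ∧
    B7.Concl X.L7 X.c₂ X.C₀ X.c₂' X.one7 X.kst7 X.kexp7 X.gd7 X.gone7 ∧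
      B8LeafR X.d8 X.L8 X.C₂ X.B₁' X.B₀' X.B₁ X.B₂ X.c₁ X.inp8 X.B₀β X.loc8 X.fam8R X.lan8 X.cub8 X.toAxial8 ∧
        B9LeafX Y ∧ B11Leaf Z

/-- Bookkeeping (`Iff.rfl` up to the binding's definitional unfolding): `SeriesInputs` is the conjunction of the leaves
b5, b6, b7, b8, b9, b11 of `Upstream.ofPrintedAllXP X Y Z V W` for ANY B14/B15 carriers V, W (which the 3D lane never
uses). [cite: Balaban1985UV3, References [2]–[7] p.274] -/
theorem seriesInputs_iff (X : PrintedCarriersR) (Y : PrintedCarriers9X) (Z : PrintedCarriers11)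
    (V : PrintedCarriers14R) (W : PrintedCarriers15) :
    SeriesInputs X Y Z ↔
      (Upstream.ofPrintedAllXP X Y Z V W).b5 ∧ (Upstream.ofPrintedAllXP X Y Z V W).b6 ∧
        (Upstream.ofPrintedAllXP X Y Z V W).b7 ∧ (Upstream.ofPrintedAllXP X Y Z V W).b8 ∧
          (Upstream.ofPrintedAllXP X Y Z V W).b9 ∧ (Upstream.ofPrintedAllXP X Y Z V W).b11 :=
  Iff.rfl

/-- Bookkeeping: with the series inputs, the 4D DAG edge `Dag.B10_main`-shaped implication for the P-binding delivers its
b10 leaf (`B10.Thm1Printed ∧ B10.Thm2Printed` over `X.runs10`) — recorded only to show WHERE the lane's binders sit in the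
DAG; the 3D lane does NOT use this route (its end theorem is proved from the spine, and the literal `Thm1Printed`
conjunct is the settled negative edge G-B10-01). [cite: Balaban1985UV3, Thm 1 p.257, Thm 2 p.272] -/
theorem b10_of_edge (X : PrintedCarriersR) (Y : PrintedCarriers9X) (Z : PrintedCarriers11)
    (V : PrintedCarriers14R) (W : PrintedCarriers15)
    (edge : let u := Upstream.ofPrintedAllXP X Y Z V W; u.b5 → u.b6 → u.b7 → u.b8 → u.b9 → u.b11 → u.b10)
    (h : SeriesInputs X Y Z) : (Upstream.ofPrintedAllXP X Y Z V W).b10 :=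
  edge h.1 h.2.1 h.2.2.1 h.2.2.2.1 h.2.2.2.2.1 h.2.2.2.2.2

/-! ## §2 Re-exports, grouped by cited paper (no new declaration) -/

-- [7] = B11, CMP 102:277
export Literature.MathematicalPhysics.QuantumFieldTheory.Balaban1983to89.B11
  (Thm1Printed Prop2Printed Prop4Printed Prop7Printed SectFPrinted Prop9Printed)
export Literature.MathematicalPhysics.QuantumFieldTheory.Balaban1983to89.DagBinding
  (B11Leaf B8LeafR B9LeafX B6BlockParam PrintedCarriers11 PrintedCarriers9X PrintedCarriersR)
export Literature.MathematicalPhysics.QuantumFieldTheory.Balaban1983to89.B11Eq174Chart (chartH)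
export Literature.MathematicalPhysics.QuantumFieldTheory.Balaban1983to89.B11Eq174Chart.Regime (chartH_eq174 eq175)
export Literature.MathematicalPhysics.QuantumFieldTheory.Balaban1983to89.B11Eq81Expansion (functional74 V80 IsCritical82)
-- [4] = B7, CMP 98
export Literature.MathematicalPhysics.QuantumFieldTheory.Balaban1983to89.B7 (Prop1Printed Prop3Printed Concl)
export Literature.MathematicalPhysics.QuantumFieldTheory.Balaban1983to89.B7Eq92Concrete
  (tild dbavgCov tild_eq_frame_dbavgCov)
-- [6] = B8, CMP 99:75
export Literature.MathematicalPhysics.QuantumFieldTheory.Balaban1983to89.B8 (Lemma1Printed)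
export Literature.MathematicalPhysics.QuantumFieldTheory.Balaban1983to89.B10SectAStatements (Eq12 Eq17)
-- [5] = B9, CMP 99:389
export Literature.MathematicalPhysics.QuantumFieldTheory.Balaban1983to89.B9
  (Thm310Printed Thm37_39_310Printed Thm315Printed Thm315FullPrinted)
export Literature.MathematicalPhysics.QuantumFieldTheory.Balaban1983to89.B9SectECov (eq_3157 eq_3157_flucCov)
export Literature.MathematicalPhysics.QuantumFieldTheory.Balaban1983to89.B9Eq3185 (K3183)
-- [2] = B5, [3] = B6
export Literature.MathematicalPhysics.QuantumFieldTheory.Balaban1983to89.B5 (MainBlock)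
-- [8] = B1 (3.24), [9] = B2 Sect. 3.C
export Literature.MathematicalPhysics.QuantumFieldTheory.Balaban1983to89.B1Sect3Statements (Eq324)
export Literature.MathematicalPhysics.QuantumFieldTheory.Balaban1983to89.B1Eq324CumulantTaylor (eq324_of_truncated_bound)
export Literature.MathematicalPhysics.QuantumFieldTheory.Balaban1983to89.B2 (Claim342Printed)
export Literature.MathematicalPhysics.QuantumFieldTheory.Balaban1983to89.B2Sect3C (Leaf347)

/-! ## §3 Named gap binders — inputs [B10] uses but neither prints nor cites with a value (lane GAP rows)

Hypothesis-shaped: a `def … : Prop` over EXPLICIT parameters (nothing ∃-quantified, nothing asserted), its docstring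
quoting the sentence of [B10] that invokes the input and the cited loci re-read on the renders; consumers take
`(h : …)` and cite the declaration by name; one kernel-checked theorem shows the binder is exactly what the printed
step consumes. -/

section Gap

open Metric
open Literature.Analysis.Complex (taylorPolynomial)

variable {E : Type*} [NormedAddCommGroup E] [NormedSpace ℂ E]
  {F : Type*} [NormedAddCommGroup F] [NormedSpace ℂ F]

/-- **G3D-01 — analyticity of the chart pull-back `B ↦ 𝒫′(g, X, exp i𝓗(B))`, AS CITED; its RADIUS and its BOUND on a
complex ball are NOT IN PRINT.**  [B10] p. 263 L3–7 «The second is a localization property with respect to U₁. The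
expression 𝒫′₁(g₀, X, U₁) depends on U₁ restricted to the set X̃⁵ (let us recall that X̃⁵ = ∪_{□⊂X} □̃⁵). The third
property is the analyticity with respect to U₁. These properties follow from the results of previous papers; let us
make a comment only on the gauge invariance (26).»; p. 263 L15–20 «We apply the constructions and results of Sect.
F [7]. According to these there exists a gauge transformation in a neighbourhood of □₁, where □₁ is a cube of the size
3RM₁ and with the same center as □, such that the gauge transformed U₁ is represented as exp i𝓗(B) in the
neighbourhood of □₁. The function 𝓗(B) is represented as 𝓗(B) = HB + A₁, where HB corresponds to a linearized theory,
and A₁ is a non-linear perturbation determined by Eq. (158) [7].»; p. 263 L25–32 «The characteristic functions χ₁ defined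
in (13) give the restrictions |V(∂p′) − 1| < 2L²g₀p(g₀), hence (28) |B(c)| < 4L²|c₋ − y|g₀p(g₀) < 8L²3R₁M₁r(g₀)g₀p(g₀), and
for g₀ sufficiently small the number on the right-hand side above is small. This bound, with a different absolute
constant, extends to the whole configuration B, and this assures that the theorems of [7] are applicable in the present
situation. The bound (28) implies a similar bound for 𝓗(B), with the additional constant B₃ on the right-hand side.»;
p. 263 L33–36 «By the gauge invariance (26), we have (29) 𝒫′₁(g₀, X, U₁) = 𝒫′₁(g₀, X, exp i𝓗(B)), and we expand the
function with respect to 𝓗(B). Because of the bound (28) it is enough to expand up to the sixth order, hence (30)»;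
p. 264 L12–15 «Let us consider the terms in the sum over n in (30). The function 𝓗(B) = HB + A₁ is determined by the
solution A₁ of Eq. (158) [7], and this solution is an analytic function of HB, or B. We expand it up to the sixth order
at most, and we estimate remainders by the last term in (30).»; the k-th step, p. 270 (after (59))–p. 271 L4 «The terms
𝒫′_{k+1} satisfy the bound (25) (with the indices 1, 0 replaced by k + 1, k), and are gauge invariant functions of
U_{k+1}, in fact of an arbitrary gauge field configuration having regularity properties similar to the properties of
U_{k+1}. We use results of Sect. F [7], and we construct the representation U_{k+1} = exp iη𝓗(B) (modulo a gauge
transformation) in a neighbourhood of □₁. … We expand the function 𝒫′_{k+1}(g_k, X, exp iη𝓗(B)) with respect to 𝓗(B)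
at first, up to the sixth order, so we have the formula (30) (for η-scale).»  THE CITED LOCI, re-read by this seat on
the renders `…/1985-cmp102-variational-background/` p026, p027 (and p029, p033 for rows B11-SectG-174-175 / B11-Prop9):
[7] Sect. F p. 302 (158) «A₁ + G̃((δ/δA′)V)(A₁ + HB) = 0.» with «The image of U′_k translated by −HB satisfies Eq. (158).
We assume that it belongs to the domain on which this equation has a unique solution, i.e. we assume that
40dL²B₁Mε₀ ≤ a₄.»; p. 303 (159) «A = A₁ + HB − HD(A₁ + HB),», (160) «|B(x, x′)| < (8d²L² + 4L²|x − y|)ε₁ for ⟨x, x′⟩ ∈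
□′_k^{(k−1)} ∪ □″_k^{(k)}.»; Sect. G p. 305 «it is an analytic function of B = (1/i) log V′ and it has an expansion as a
power series in B», Prop. 9 p. 309 «The function 𝓗(B) is determined by Eqs. (174), (175), or (179), (180). It is an
analytic function of B, …».  WHAT IS NOT PRINTED, in [B10] or at the cited loci: a RADIUS of analyticity of
`𝓗 ↦ 𝒫′₁(g₀, X, exp i𝓗)` / `B ↦ 𝒫′₁(g₀, X, exp i𝓗(B))` (the cluster-expansion activity of (23)–(25), analytic in U₁ «from
the results of previous papers», composed with the chart of [7]) and a BOUND for it on a complex ball — exactly the two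
inputs the seventh-order remainder of (30) consumes (LQB `B10SectAGathering.taylor7_remainder_le`, hypotheses `hΦ`,
`hMX`; pub-balaban cell GAPS G-B10-04; lane GAP row G3D-01, PLAN §2.5).  TYPED AS A HYPOTHESIS with the radius `ρ` and
the bound `M` as explicit parameters (∃-free; the user supplies the values and carries them to the constants of (33)/
(60)): over a complex normed space `E` of configurations (𝓗 or B, the lattice being finite) and a complex normed space
`F` of values, `Ψ` is holomorphic on `ball 0 ρ`, `0 < ρ`, and `‖Ψ z‖ ≤ M` on `closedBall 0 (ρ/2)`.  Consumers cite this
declaration BY NAME (lane seat p6, `ChartExpansion`: the fields `ρ_pos`/`analytic`/`bound` per localization X are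
`ChartAnalyticityAsCited (Ψ X) ρ (M X)`).
[cite: Balaban1985UV3, p.263 L5–6 + (28)–(30) p.263 + p.264 L12–15 + p.271 L1–4; Balaban1985Variational, (158) p.302 + Prop. 9 p.309] -/
def ChartAnalyticityAsCited (Ψ : E → F) (ρ M : ℝ) : Prop :=
  0 < ρ ∧ DifferentiableOn ℂ Ψ (ball 0 ρ) ∧ ∀ z ∈ closedBall (0 : E) (ρ / 2), ‖Ψ z‖ ≤ M

namespace ChartAnalyticityAsCited

variable {Ψ : E → F} {ρ M : ℝ}

/-- The bound `M` of `ChartAnalyticityAsCited Ψ ρ M` is nonnegative (it bounds `‖Ψ 0‖`). Bookkeeping over the binder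
G3D-01. [cite: Balaban1985UV3, (30) p.263] -/
theorem bound_nonneg (h : ChartAnalyticityAsCited Ψ ρ M) : 0 ≤ M :=
  (norm_nonneg (Ψ 0)).trans (h.2.2 0 (mem_closedBall_self (by have := h.1; positivity)))

/-- **G3D-01 is exactly the analyticity input of (30).**  [B10] p. 263 L35–36 «Because of the bound (28) it is enough
to expand up to the sixth order, hence (30) 𝒫′₁(g₀, X, exp i𝓗(B)) = 𝒫′₁(g₀, X, 1) + ⟨(δ/δ𝓗 𝒫′₁)(g₀, X, 1), 𝓗(B)⟩ +
Σ_{n=2}^{6} (1/n!)⟨(δⁿ/δ𝓗ⁿ 𝒫′₁)(g₀, X, 1), ⊗ⁿ𝓗(B)⟩ + O(g₀⁷)e^{−κ𝓛(X)}.»: under `ChartAnalyticityAsCited Ψ ρ M` and «the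
bound (28)» in the form `‖B‖ ≤ s ≤ ρ/4`, the sixth-order Taylor polynomial of (30) approximates `Ψ B` within
`2·M·(2s/ρ)⁷` — LQB `B10SectAGathering.taylor7_remainder_le` BY NAME, fed with the three components of the binder.
[cite: Balaban1985UV3, (30) p.263] -/
theorem remainder30 [FiniteDimensional ℂ E] [CompleteSpace F] (h : ChartAnalyticityAsCited Ψ ρ M) {s : ℝ}
    (hs : 0 < s) (hsρ : s ≤ ρ / 4) {B : E} (hB : ‖B‖ ≤ s) :
    ‖Ψ B - taylorPolynomial Ψ 0 7 B‖ ≤ 2 * M * (2 * s / ρ) ^ 7 :=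
  B10SectAGathering.taylor7_remainder_le h.1 h.2.1 h.2.2 hs hsρ hB

end ChartAnalyticityAsCited

/-! ### G3D-02 «graph representation of the sixth-order cumulant terms» (lead-g2 2026-08-22T00:04:18Z; p5 G-p5-1) -/

/-- **CARRIER for G3D-02 — the graph/walk-labelled expressions of «the calculation» of [B10] p. 262 (DATA ONLY;
nothing asserted).**  p. 262 L1–8 «Next, the integral is calculated by the cumulant expansion formula (3.24) [8], again
up to the sixth order in g₀. A result of the calculation can be represented by lower order connected vacuum graphs with
vertices determined by the expansions of the function 𝓋(g₀A) − 1/g₀² Ṽ(g₀A). The vertices are represented by sums over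
almost local expressions, i.e. expressions involving field variables A localized to a union of several neighbouring
blocks. They have at most eight legs, and the graphs have at most six vertices.»; L9–16 «We analyze these perturbative
expressions in a way similar to the analysis in [10]. We localize vertices in big blocks by a decomposition of unity,
and we expand the propagators C^{(0)}(Ω₁, U₁) into the generalized random walk expansion described in [5], Theorem 3.15,
Theorem 3.10 and the preceding theorems. This gives a sum of expressions having the following structure. Each expression
corresponds to a graph with vertices localized in cubes {□ᵢ}. A line of the graph connecting vertices □ᵢ, □ⱼ is replaced
by a random walk ω = ((α₀, X₀), (α₁, X₁), …, (αₙ, Xₙ)) satisfying □ᵢ ∩ X₀ ≠ ∅, X_{m−1} ∩ X_m ≠ ∅, m = 1, …, n,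
X_m ∩ □ⱼ ≠ ∅.»; L19–22 «Let us recall that the sets X_m are connected unions of several big blocks. The localizations {□ᵢ}
and the walks ω replacing lines of the graph define a localization X of the considered expression. This localization is
simply a union of all these sets.»  Fields: `Γ`/`supp` = the finite set of expressions γ (graph + cube localizations of
its vertices + one walk per line); `E γ U` = the value of γ at the argument `U` (U₁ at the first step; at step k the
user's `Cfg` carries the pair (history, U_{k+1}) of (55)–(59)); `loc γ` = the localization X of γ in the scale's system
of localization domains `D` (LQB `Setup.LocDomainSys`: a finite type of domains with the tree length `D.dj` = 𝓛 of
p. 262 L32–36 «Following [19] we define a linear size 𝓛(X) of a localization X as the length of a shortest tree graph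
connecting the centers of big blocks in X, and other points, if the big blocks are scaled to unit cubes»; the cube
geometry — «union of all these sets» — is abstracted exactly as in LQB, DIVERGENCE F5 there); `nv γ` = the number of
vertices of the graph; `pref γ` = the walk-independent prefactor of γ (the vertex factors: powers of g₀ from «the
expansions of the function 𝓋(g₀A) − 1/g₀² Ṽ(g₀A)», (Lʲη)-powers, the O(1)'s — the O(g₀) of (25) lives here); `lines γ` =
the graph's lines as pairs (|ω|, d(ω, □ᵢ, □ⱼ)) (walk length, «the length of a shortest tree graph passing through □ᵢ, □ⱼ,
{X_m}» p. 262 L19–20).  [cite: Balaban1985UV3, p.262 L1–22] -/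
structure GraphTerms (D : LocDomainSys) (Cfg : Type) where
  /-- labels γ of the expressions (graphs with localized vertices and walks for lines) -/
  Γ : Type
  /-- the finitely many expressions of the sixth-order calculation -/
  supp : Finset Γ
  /-- value of the expression γ -/
  E : Γ → Cfg → ℝ
  /-- «a localization X of the considered expression» -/
  loc : Γ → D.Dom
  /-- number of vertices of the graph of γ -/
  nv : Γ → ℕ
  /-- walk-independent prefactor (vertex factors) -/
  pref : Γ → ℝ
  /-- the lines of the graph: (|ω|, d(ω, □ᵢ, □ⱼ)) per line -/
  lines : Γ → List (ℕ × ℝ)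

namespace GraphTerms

variable {D : LocDomainSys} {Cfg : Type} (G : GraphTerms D Cfg)

/-- The right-hand side of **(23)** for the expression γ: `pref γ · Π_{(n, d) ∈ lines γ} walkFactor C c M₁ δ₀ n d`, ONE
factor (23) = (3.108) [5] per line — p. 262 L16–18 «A term in the expression, corresponding to the walk ω, satisfies the
bound (3.108) [5], i.e. can be bounded by (23) O(1)O(M₁^{−(1/2)})^{|ω|}M₁^{−(1/2)|ω|} exp(−½δ₀d(ω, □ᵢ, □ⱼ))» — with the
factor of (3.94)/(3.108) [5] BY NAME: LQB `B9.walkFactor C c M δ₀ n dω = C·(c·M^{−1/2})ⁿ·M^{−n/2}·e^{−½δ₀dω}` (the two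
printed O(1)'s = C, c; [5] Thm 3.10 p. 416 «The constant O(1) depends on d and L only»; row B9-Thm310 above and LQB
`B10Eq25Rate.WalkTermBound23`, the one-walk analytic-space form of the same hypothesis). [cite: Balaban1985UV3, (23) p.262] -/
noncomputable def bound23 (C c M₁ δ₀ : ℝ) (γ : G.Γ) : ℝ :=
  G.pref γ * ((G.lines γ).map fun l => B9.walkFactor C c M₁ δ₀ l.1 l.2).prod

/-- **«Summing the expressions with the same localization X»** (p. 262 L27): the activities
`𝒫′(X, U) := Σ_{γ ∈ supp, loc γ = X} E γ U`, packaged as LQB's (24)–(25) carrier `B10.PolymerActivities` with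
`Poly := D.Dom`, `ℒ := D.dj` — so that **(25)** for them is LITERALLY `B10.Bound25Printed G.activities g κ C` (RE-USE;
SPINE-COVERAGE row (25)) and **(24)** is the typed inequality over LQB `B10Eq24Cumulant` (row (24)).
[cite: Balaban1985UV3, (24)–(25) p.262] -/
noncomputable def activities [DecidableEq D.Dom] : B10.PolymerActivities where
  Poly := D.Dom
  Cfg := Cfg
  ℒ := D.dj
  act X U := ∑ γ ∈ G.supp with G.loc γ = X, G.E γ U

end GraphTerms

/-- **G3D-02 — the graph representation of the sixth-order cumulant terms, AS DESCRIBED IN PROSE on [B10] p. 262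
(hypothesis-shaped; the expansion is not constructed in [B10], in the cited [5], or in LQB — pub-balaban cell GAPS
G-IF-04, `B10Eq25Rate` header «WHAT IS NOT CERTIFIED … the expansion itself and the bound (23) for the actual
perturbative expressions … graphs with SEVERAL lines … the finite product version is not typed»).**  Over a carrier
`G : GraphTerms D Cfg` and the user's `cum : Cfg → ℝ` = «A result of the calculation» (the sum of the truncated
expectations of (3.24) [8] up to the sixth order, whose exponential bounds the fluctuation integral of (22)/(55) — row
B1-324, LQB `B1Sect3Statements.Eq324`), the binder says, with the constants `C, c, M₁, δ₀` of (23) explicit (∃-free):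
(i) p. 262 L12–13 «This gives a sum of expressions» — `cum U = Σ_{γ ∈ supp} E γ U`; (ii) p. 262 L7–8 «They have at most
eight legs, and the graphs have at most six vertices» — `nv γ ≤ 6` and `2·#lines γ ≤ 8·nv γ` ⟦reading: every line of a
vacuum graph consumes two legs⟧; (iii) `0 ≤ pref γ` ⟦carrier normalisation, NOT IN PRINT: the sign of a term is absorbed
into `E`, so that `bound23 ≥ 0`; REFEREE F-21⟧; (iv) p. 262 L16–18, (23) — `|E γ U| ≤ G.bound23 C c M₁ δ₀ γ` (one
factor (3.108) [5] per line, LQB `B9.walkFactor` BY NAME).  THE CITED LOCUS, re-read by this seat ([5] = [B9] CMP 99:389,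
render p028 = p. 416): Theorem 3.10 «For M sufficiently large, and a configuration U satisfying (3.95), the operator G
has the expansion (3.107) G = Σ_ω R₀(X₀)R_{α₁}(X₁)·…·R_{αₙ}(Xₙ), the sum is over walks ω = ((0, X₀), (α₁, X₁), …, (αₙ, Xₙ))
satisfying X_{i−1} ∩ X_i ≠ ∅, i = 1, …, n. A term in this expansion, corresponding to a walk ω, depends on configuration
U restricted to X̃₀⁵ ∪ X̃₁⁵ ∪ … ∪ X̃ₙ⁵, satisfies the inequality (3.108) |(R₀(X₀)R_{α₁}(X₁)·…·R_{αₙ}(Xₙ)J)(x)| ≤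
O(1)(Lʲη)²O(M^{−1/2})^{|ω|}·M^{−1/2|ω|}e^{−(1/2)δ₀d(ω,y,y′)}|J|, x ∈ Δ(y), y ∈ Λ_j, supp J ⊂ Δ(y′), … The constant O(1)
depends on d and L only.» (LQB `B9.Thm310Printed`, `B9.Thm37_39_310Printed`; row B9-Thm310).  NOT IN THIS BINDER (they
stay where SPINE-COVERAGE has them): the smallness consequences p. 262 L22–27 («the expressions corresponding to big
localization sets X are very small … exp(−R) … O(ε^κ)|T₁|») = LQB `B10Eq59Localization`/`B10Eq25Rate.rate25` tools and
p5's lemma; (24) itself (row (24), `B10Eq24Cumulant`); (25) (row (25), `B10.Bound25Printed` on `G.activities`); the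
k-th step p. 270 (after (58)) «We calculate the last integral using the cumulant expansion formula again up to sixth
order in g_k … connected graphs … generalized random walk expansions» instantiates the same carrier at scale k.
Consumers: p5 (leaves `Cumulant58`/`CumulantLower`, hypotheses = row B1-324 BY NAME + this binder + (25)), p1 (the
`PprU` slot of `StepPieces` := the retained part of `Σ_X G.activities.act X`, by `GraphRep23AsCited.cum_eq_sum_activities`).
[cite: Balaban1985UV3, p.262 L1–28 + (23); Balaban1985BackgroundPropagators, Thm 3.10 (3.107)–(3.108) pp.415–416] -/
def GraphRep23AsCited {D : LocDomainSys} {Cfg : Type} (G : GraphTerms D Cfg) (cum : Cfg → ℝ) (C c M₁ δ₀ : ℝ) : Prop :=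
  (∀ U, cum U = ∑ γ ∈ G.supp, G.E γ U) ∧
  (∀ γ ∈ G.supp, G.nv γ ≤ 6 ∧ 2 * (G.lines γ).length ≤ 8 * G.nv γ) ∧
  (∀ γ ∈ G.supp, 0 ≤ G.pref γ) ∧
  ∀ γ ∈ G.supp, ∀ U, |G.E γ U| ≤ G.bound23 C c M₁ δ₀ γ

namespace GraphRep23AsCited

variable {D : LocDomainSys} {Cfg : Type} {G : GraphTerms D Cfg} {cum : Cfg → ℝ} {C c M₁ δ₀ : ℝ}

/-- A sixth-order vacuum graph of p. 262 has at most 24 lines (≤ 6 vertices, ≤ 8 legs each, two legs per line).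
Bookkeeping over the binder G3D-02. [cite: Balaban1985UV3, p.262 L7–8] -/
theorem length_lines_le (h : GraphRep23AsCited G cum C c M₁ δ₀) {γ : G.Γ} (hγ : γ ∈ G.supp) :
    (G.lines γ).length ≤ 24 := by
  obtain ⟨h6, h8⟩ := h.2.1 γ hγ
  omega

/-- **p. 262 L27 «Summing the expressions with the same localization X we get finally the inequality (24)»** — the
regrouping is exact bookkeeping: `cum U = Σ_{X ∈ D.Dom} 𝒫′(X, U)` with `𝒫′ = G.activities.act` (fiberwise summation
over the finite type of localization domains).  Kernel-checked from clause (i). [cite: Balaban1985UV3, (24) p.262] -/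
theorem cum_eq_sum_activities [DecidableEq D.Dom] (h : GraphRep23AsCited G cum C c M₁ δ₀) (U : Cfg) :
    cum U = ∑ X : D.Dom, G.activities.act X U := by
  rw [h.1 U]
  exact (Finset.sum_fiberwise G.supp G.loc (fun γ => G.E γ U)).symm

/-- **(23) summed inside one localization**: `|𝒫′(X, U)| ≤ Σ_{γ ∈ supp, loc γ = X} bound23 γ` — the triangle
inequality over clause (iv); the input of the (23) ⇒ (25) summation (p. 262 L22–27; LQB `B10Eq25Rate`,
`B10Eq59Localization`). [cite: Balaban1985UV3, (23)–(25) p.262] -/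
theorem abs_act_le [DecidableEq D.Dom] (h : GraphRep23AsCited G cum C c M₁ δ₀) (X : D.Dom) (U : Cfg) :
    |G.activities.act X U| ≤ ∑ γ ∈ G.supp with G.loc γ = X, G.bound23 C c M₁ δ₀ γ := by
  refine (Finset.abs_sum_le_sum_abs _ _).trans (Finset.sum_le_sum fun γ hγ => ?_)
  exact h.2.2.2 γ (Finset.mem_filter.mp hγ).1 U

end GraphRep23AsCited

/-! ### G3D-04 «(35) at the k-th step» (lead-g2 batch 4 (2/3), 2026-08-22T00:17:23Z; p6 (B); LEAF-LEDGER C8) -/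

/-- **G3D-04 — the normalisation bound (35) AT STEP k ≥ 1, NOT IN PRINT (hypothesis-shaped; RE-USE of LQB's located
model data BY NAME).**  [B10] p. 265 L8–11 «Finally we normalize log Z^{(0)}(Ω₁, U₁) subtracting and adding the term
log Z^{(0)}(Ω₁, 1), which we have to supplement to the whole lattice using the bound (35) |log (Z^{(0)}(Ω₁, 1)/Z^{(0)}(T₁, 1))|
≤ O(1)|Ω₁ᶜ|.» (asserted at k = 0, no proof in print; SPINE-COVERAGE row (35) = RE-USE, an (α) DATA display); at the
k-th step the analogue `|log Z^{(k)}(B(Λ_{k+1}), 1) − log Z^{(k)}(T₁^{(k)}, 1)| ≤ O(1)·|Z_k|` is used silently between (61)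
p. 271 L17 «log Z^{(k)}(B(Λ_{k+1}), U_{k+1}) − log Z^{(k)}(B(Λ_{k+1}), 1)» and (62) p. 271 L19 «E^{(k)} = log σ₀|T₁^{(k)*}| +
d(𝔤) log g_k|T₁^{(k)*}| + log Z^{(k)}(T₁^{(k)}, 1) + Σ_X 𝒫′_{k+1}(g_k, X, 1)» ((55) carries log Z^{(k)}(B(Λ_{k+1}), U_{k+1}),
E^{(k)} carries log Z^{(k)}(T₁^{(k)}, 1)) — pub-balaban cell GAPS G-B10-07 (a), LQB leaf `B10SectAGathering.Norm35`.  TYPED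
CONTENT = LQB `B10Eq35Norm.Norm35Model P c a cv cJ h` BY NAME (the located hypotheses: both numbers are
constraint-elimination constants plus log-Gaussians of block precision forms with Loewner bounds `[c, a]` — positivity =
[5] Thm 3.11, binder b9 —, the extra coordinates and the two constants differ by `≤ cv·|Z_k|`, `≤ cJ·|Z_k|`), demanded
for EVERY level-(k+1) history as a `Nonempty` proposition (the form the end theorem's hypothesis list names; the
constants `c a cv cJ` explicit, ∃-free).  Consumer: p6 (C8 closes by `Norm35StepAsCited.norm35` below).
[cite: Balaban1985UV3, (35) p.265 + (61)–(62) p.271] -/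
def Norm35StepAsCited {T : B10.TowerRun} {k : ℕ} (P : B10SectAGathering.StepPieces T k) (c a cv cJ : ℝ) : Prop :=
  ∀ h : T.Hist (k + 1), Nonempty (B10Eq35Norm.Norm35Model P c a cv cJ h)

/-- **G3D-04 feeds the leaf `Norm35`**: under `Norm35StepAsCited P c a cv cJ` with `0 < c`, LQB
`B10Eq35Norm.norm35_of_model` BY NAME gives `Norm35 P (cv·(log 2π + max(|log c|, |log a|))/2 + cJ)` — the O(1) of (35)
COMPUTED from the model constants. [cite: Balaban1985UV3, (35) p.265] -/
theorem Norm35StepAsCited.norm35 {T : B10.TowerRun} {k : ℕ} {P : B10SectAGathering.StepPieces T k}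
    {c a cv cJ : ℝ} (hc : 0 < c) (h : Norm35StepAsCited P c a cv cJ) :
    B10SectAGathering.Norm35 P (cv * ((Real.log (2 * Real.pi) + max |Real.log c| |Real.log a|) / 2) + cJ) :=
  B10Eq35Norm.norm35_of_model hc fun h' => (h h').some

/-! ### G3D-05 «log Z^{(k)}(T₁^{(k)}, 1) is a volume term» (lead-g2 batch 4 (2/3); p6 (B); LEAF-LEDGER B20)

The located model data and their bookkeeping were drafted by the lane's p6 seat (HOME drafts/p6/LogZBounds.lean,
rc0) and are vendored HERE at p6's and the lead's request (p6 2026-08-22T00:22:14Z; one home for the statement,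
no Summits-side twin). -/

section LogZ

open scoped Matrix
open Matrix MeasureTheory

/-- **Volume law for ONE Gaussian normalisation** (the arithmetic behind G3D-05 and (35)): for a symmetric precision
form `Q` on `ℝⁿ` with `c·1 ⪯ Q ⪯ a·1`, `0 < c`, `|log ∫ e^{−½⟨v,Qv⟩} dv| ≤ |n|·(log 2π + max(|log c|, |log a|))/2` —
`log ∫ = (|n|/2) log 2π − ½ log det Q` (LQB `Beta.GaussianIntegral.log_integral_exp_neg_half_quadForm`) and
`|log det Q| ≤ |n|·max(|log c|, |log a|)` (LQB `B10Eq35Norm.abs_log_det_le_of_form_bounds`).  Kernel-checked real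
analysis (drafted by p6); it is the content of p. 271 L22–28 «we obtain the Gaussian integral determined by the positive
quadratic form ⟨A, C*Δ_kCA⟩» ⟦sic: = ⟨Ã, C*Δ_kCÃ⟩⟧ + p. 272 L1–2 «The number γ₁ is an upper bound of the positive, bounded operator C*Δ_kC»
read as a volume bound. [cite: Balaban1985UV3, p.271 L22–28 + p.272 L1–2] -/
theorem abs_log_gaussian_le {n : Type*} [Fintype n] [DecidableEq n] {Q : Matrix n n ℝ} {c a : ℝ} (hc : 0 < c)
    (hlo : (Q - c • (1 : Matrix n n ℝ)).PosSemidef) (hhi : (a • (1 : Matrix n n ℝ) - Q).PosSemidef) :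
    |Real.log (∫ v : n → ℝ, Real.exp (-(1/2 : ℝ) * (v ⬝ᵥ Q *ᵥ v)))|
      ≤ Fintype.card n * ((Real.log (2 * Real.pi) + max |Real.log c| |Real.log a|) / 2) := by
  have hQh : Q.IsHermitian := B10Eq35Norm.isHermitian_of_sub_smul_one_posSemidef hlo
  have hQpd : Q.PosDef :=
    B10Eq35Norm.posDef_of_le_form hQh hc (B10Eq35Norm.le_form_of_sub_smul_one_posSemidef hlo)
  have hdet := B10Eq35Norm.abs_log_det_le_of_form_bounds hQh hc
    (B10Eq35Norm.le_form_of_sub_smul_one_posSemidef hlo) (B10Eq35Norm.form_le_of_smul_one_sub_posSemidef hhi)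
  rw [Beta.GaussianIntegral.log_integral_exp_neg_half_quadForm _ hQpd]
  have hN : (0 : ℝ) ≤ Fintype.card n := Nat.cast_nonneg _
  have hL0 : 0 ≤ Real.log (2 * Real.pi) := B10Eq35Norm.log_two_pi_nonneg
  calc |(Fintype.card n : ℝ) / 2 * Real.log (2 * Real.pi) - 1 / 2 * Real.log Q.det|
      ≤ |(Fintype.card n : ℝ) / 2 * Real.log (2 * Real.pi)| + |1 / 2 * Real.log Q.det| := abs_sub _ _
    _ = (Fintype.card n : ℝ) / 2 * Real.log (2 * Real.pi) + 1 / 2 * |Real.log Q.det| := by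
        rw [abs_mul, abs_mul, abs_of_nonneg (by positivity : (0 : ℝ) ≤ Fintype.card n / 2), abs_of_nonneg hL0,
          abs_of_nonneg (by norm_num : (0 : ℝ) ≤ 1 / 2)]
    _ ≤ (Fintype.card n : ℝ) / 2 * Real.log (2 * Real.pi)
        + 1 / 2 * (Fintype.card n * max |Real.log c| |Real.log a|) := by gcongr
    _ = Fintype.card n * ((Real.log (2 * Real.pi) + max |Real.log c| |Real.log a|) / 2) := by ring

variable {T : B10.TowerRun} {k : ℕ}

/-- **MODEL DATA for `log Z^{(k)}(T₁^{(k)}, 1)`** (G3D-05's located hypotheses, in the letters of LQB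
`B10Eq35Norm.Norm35Model`; drafted by p6).  [B10] p. 271 L20–28 «To complete the proof of the inductive assumption (41)
we have to expand the term (61) analogously to (60). … We write it as the logarithm of the Gaussian integral determined
by the quadratic form ⟨A, Δ_kA⟩ and the δ-functions δ(QA)δ_{Ax}(A). We eliminate the δ-functions and we write the
integral in terms of the independent variables Ã introduced at the beginning of Sect. E [5]. They are connected with A
by the simple linear operator C described there, A = CÃ, and we obtain the Gaussian integral determined by the positive
quadratic form ⟨A, C*Δ_kCA⟩.» ⟦sic: = ⟨Ã, C*Δ_kCÃ⟩, as the preceding «in terms of the independent variables Ã» says⟧; p. 272 L1–2 «The number γ₁ is an upper bound of the positive, bounded operator C*Δ_kC.»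
(Z^{(k)} is not defined in print beyond these sentences — cell GAPS G-B10-03.)  Fields: the printed number `P.logZT` (=
log Z^{(k)}(T₁^{(k)}, 1) of (62), LQB `StepPieces.logZT`) IS a constraint-elimination constant `J` plus the log-Gaussian
of a precision form `Q` on `ℝ^{dim}` (`logZT_eq`); `c·1 ⪯ Q ⪯ a·1` (`lower` = positivity of the constrained form, [5]
Thm 3.11, binder b9 `B9.Thm311Printed`; `upper` = γ₁); the UNPRINTED COUNTS `dim ≤ cn·|T₁^{(k)}|` (the variables Ã live
on bonds of T₁^{(k)}) and `|J| ≤ cJ·|T₁^{(k)}|` (per-block local δ-functions).  Nothing is asserted; a construction of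
Bałaban's Z^{(k)} would have to supply a term of this structure. [cite: Balaban1985UV3, (61)–(62) p.271 + p.272 L1–2] -/
structure LogZTModel (P : B10SectAGathering.StepPieces T k) (c a cn cJ : ℝ) where
  /-- number of integration variables Ã -/
  dim : ℕ
  /-- the precision form C*Δ_kC in the variables Ã -/
  Q : Matrix (Fin dim) (Fin dim) ℝ
  /-- constraint-elimination constant -/
  J : ℝ
  lower : (Q - c • (1 : Matrix (Fin dim) (Fin dim) ℝ)).PosSemidef
  upper : (a • (1 : Matrix (Fin dim) (Fin dim) ℝ) - Q).PosSemidef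
  logZT_eq : P.logZT = J + Real.log (∫ v : Fin dim → ℝ, Real.exp (-(1/2 : ℝ) * (v ⬝ᵥ Q *ᵥ v)))
  count_le : (dim : ℝ) ≤ cn * T.sites k
  jac_le : |J| ≤ cJ * T.sites k

/-- **`|log Z^{(k)}(T₁^{(k)}, 1)| ≤ z·|T₁^{(k)}|` from the model data** — what (65) p. 273 L3–5 «From (25), which holds for
arbitrary j, we get easily |E^{(j)}| ≤ O(1)|T₁^{(j)}|» USES of the summand log Z^{(j)}(T₁^{(j)}, 1) of (62) without printing
it (LQB `B10Assembly.LeafSystem.logZT_le` «(p. 273, implicit)»): with `0 < c`,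
`|P.logZT| ≤ (cn·(log 2π + max(|log c|, |log a|))/2 + cJ)·T.sites k`.  Kernel-checked bookkeeping over
`abs_log_gaussian_le` (drafted by p6). [cite: Balaban1985UV3, (62) p.271 + (65) p.273] -/
theorem LogZTModel.logZT_le {P : B10SectAGathering.StepPieces T k} {c a cn cJ : ℝ} (hc : 0 < c)
    (M : LogZTModel P c a cn cJ) :
    |P.logZT| ≤ (cn * ((Real.log (2 * Real.pi) + max |Real.log c| |Real.log a|) / 2) + cJ) * T.sites k := by
  set u : ℝ := (Real.log (2 * Real.pi) + max |Real.log c| |Real.log a|) / 2 with hu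
  have hu0 : 0 ≤ u := by
    have h1 : 0 ≤ max |Real.log c| |Real.log a| := (abs_nonneg _).trans (le_max_left _ _)
    have h2 := B10Eq35Norm.log_two_pi_nonneg
    rw [hu]; positivity
  have hG := abs_log_gaussian_le hc M.lower M.upper
  simp only [Fintype.card_fin] at hG
  rw [M.logZT_eq]
  calc |M.J + Real.log (∫ v : Fin M.dim → ℝ, Real.exp (-(1/2 : ℝ) * (v ⬝ᵥ M.Q *ᵥ v)))|
      ≤ |M.J| + |Real.log (∫ v : Fin M.dim → ℝ, Real.exp (-(1/2 : ℝ) * (v ⬝ᵥ M.Q *ᵥ v)))| := abs_add_le _ _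
    _ ≤ cJ * T.sites k + (M.dim : ℝ) * u := add_le_add M.jac_le hG
    _ ≤ cJ * T.sites k + cn * T.sites k * u := by
        have := mul_le_mul_of_nonneg_right M.count_le hu0
        linarith
    _ = (cn * u + cJ) * T.sites k := by ring

/-- **G3D-05 — «log Z^{(k)}(T₁^{(k)}, 1) is extensive», NOT IN PRINT (implicit in (65); hypothesis-shaped).**  The binder
the end theorem's hypothesis list names: the model data `LogZTModel P c a cn cJ` EXIST (`Nonempty`; constants explicit,
∃-free in the reals).  Consumer: p6 → LEAF-LEDGER B20 via `LogZTExtensiveAsCited.logZT_le`.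
[cite: Balaban1985UV3, (62) p.271 + (65) p.273] -/
def LogZTExtensiveAsCited (P : B10SectAGathering.StepPieces T k) (c a cn cJ : ℝ) : Prop :=
  Nonempty (LogZTModel P c a cn cJ)

/-- **G3D-05 feeds `LeafSystem.logZT_le`**: `|P.logZT| ≤ (cn·(log 2π + max(|log c|, |log a|))/2 + cJ)·|T₁^{(k)}|`.
[cite: Balaban1985UV3, (65) p.273] -/
theorem LogZTExtensiveAsCited.logZT_le {P : B10SectAGathering.StepPieces T k} {c a cn cJ : ℝ} (hc : 0 < c)
    (h : LogZTExtensiveAsCited P c a cn cJ) :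
    |P.logZT| ≤ (cn * ((Real.log (2 * Real.pi) + max |Real.log c| |Real.log a|) / 2) + cJ) * T.sites k :=
  h.some.logZT_le hc

end LogZ

/-! ### G3D-06 «far-localized monomials» (lead-g2 batch 5 (1/2), 2026-08-22T00:19:50Z; p6 C5/C7) -/

/-- **G3D-06 — the monomials with B localized in □₁ᶜ go into the remainder, AS STATED IN PROSE (one sentence of
justification in print; hypothesis-shaped, per localization domain).**  [B10] p. 264 L14–20 «We expand it up to the sixth
order at most, and we estimate remainders by the last term in (30). Finally we estimate terms with B localized in □₁ᶜ by
the last term in (30) with the constant proportional to an arbitrary power of g₀. It is possible because the uniform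
exponential decay of all propagators provides the exponential factor exp(−½δ₀dist(X, □₁ᶜ)) ≤ exp(−R₁r(g₀)) in this
case. Thus we obtain expressions which are polynomials in B of at least the second order, and at most the sixth order,
localized in □₁.»; k ≥ 1: p. 271 L6–8 «Next we expand 𝓗(B) with respect to B, again up to the sixth order. Finally we
estimate all terms with B localized in □₁ᶜ using the exponential decay of propagators.» (propagator decay = [5] (3.108),
binder b9, row B9-Thm310).  TYPED (p6's per-domain shape, 2026-08-22T00:22:14Z): over localizations `X : ι`, histories
`h : H` and configurations `U : C`, the dropped far part `far X h U` of the domain's (30)-expansion is bounded by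
`Cfar · (M X · c)` — `M X` = the size of the domain's (30)-terms (the G3D-01 bound of its chart function, by (25)), `c` =
the currency of «the last term in (30)» after (28) (the user's `g_k⁷(r(g_k)p(g_k))⁷`), `Cfar` absorbing «the constant
proportional to an arbitrary power of g₀» ⟦reading: the printed arbitrary power is weakened to the seventh-order currency,
which is all (33)/(60) consume⟧.  Consumer: p6 `ChartExpansion.far_le := FarTermsDecayAsCited far M κc.Cfar (g_k⁷·(r p)⁷)`.
[cite: Balaban1985UV3, p.264 L14–20 + p.271 L6–8] -/
def FarTermsDecayAsCited {ι H C : Type*} (far : ι → H → C → ℝ) (M : ι → ℝ) (Cfar c : ℝ) : Prop :=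
  ∀ X h U, |far X h U| ≤ Cfar * (M X * c)

/-- Summed form of G3D-06 over a finite set of localizations: `|Σ_{X ∈ s} far X h U| ≤ Cfar · c · Σ_{X ∈ s} M X` — the
shape in which the dropped monomials enter the O((Lᵏε)^{3+κ₀})|T₁^{(k)}| of (33)/(60) (with (25) summed, p. 264 L23–25
«We use the remaining exp(−κ₁𝓛(X)) to control a sum over all X»).  Bookkeeping. [cite: Balaban1985UV3, (33) p.264 + (60) p.271] -/
theorem FarTermsDecayAsCited.abs_sum_le {ι H C : Type*} {far : ι → H → C → ℝ} {M : ι → ℝ} {Cfar c : ℝ}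
    (hf : FarTermsDecayAsCited far M Cfar c) (s : Finset ι) (h : H) (U : C) :
    |∑ X ∈ s, far X h U| ≤ Cfar * c * ∑ X ∈ s, M X := by
  calc |∑ X ∈ s, far X h U| ≤ ∑ X ∈ s, |far X h U| := Finset.abs_sum_le_sum_abs _ _
    _ ≤ ∑ X ∈ s, Cfar * (M X * c) := Finset.sum_le_sum fun X _ => hf X h U
    _ = Cfar * c * ∑ X ∈ s, M X := by rw [Finset.mul_sum]; exact Finset.sum_congr rfl fun X _ => by ring

/-! ### G3D-07 «localized expansion of log Z^{(k)}(B(Λ_{k+1}), ·)» (lead-g4 batch 14 (1/3) R-G7, 2026-08-22T01:28:25Z,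
text field-checked R-G7′/R-G7″ 01:42–01:43Z; p6 C7 `decomp35_61_series`; LEAF-LEDGER §F F2)

Drafted Summits-side by the lane's p6 seat as the hypothesis structure `LogZLocalization` (HOME drafts/p6/LogZLocalized.lean,
rc0; handoff text drafts/p6/ForTyper2_G3D07.lean sha256 18926e5b…, referee pre-countersign F-46) and vendored HERE at the
lead's ruling R-G7 — ONE home for the statement, no Summits-side twin (p6's structure becomes the constructor
`LogZLocalization.ofCited` over the declaration below); amendments per R-G7: carriers LQB-only and scalar constants explicit
(a Literature module cannot import the lane's Summits-side `ChartConsts`), the invariance typed AS PRINTED («gauge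
invariant») over an explicit action instead of a (32)-field, and (R-G7″) only the DIFFERENCE (61) localized — the
absolute constant is not a datum of the printed claim. -/

section LogZLoc

/-- **G3D-07 — the localized expansion of the additional term (61) `log Z^{(k)}(B(Λ_{k+1}), U_{k+1}) − log Z^{(k)}(B(Λ_{k+1}),
1)`, AS CITED; NOT IN PRINT as a quantitative statement (PROSE + CITATION; hypothesis-shaped: data + Props, nothing
constructed or asserted).**  THE PRINTED TEXT (renders p017/p018/p011 re-read by this seat; line count = this module's
convention — printed lines from the top of the journal page, displays counted as lines, running head excluded; anchors
(60) = p. 271 L10–11, (61) = L16, (62) = L18, (63) = p. 272 L4–5, (35) = p. 265 L12; the referee's count F-46 agrees).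
[B10] p. 271 L19–35 «To complete the proof of the inductive assumption (41) we have to expand the term (61) analogously to
(60). It can be localized in a similar way, although a bit more complicated, as the perturbative expressions. We write it
as the logarithm of the Gaussian integral determined by the quadratic form ⟨A, Δ_kA⟩ and the δ-functions δ(QA)δ_{Ax}(A).
We eliminate the δ-functions and we write the integral in terms of the independent variables Ã introduced at the
beginning of Sect. E [5]. They are connected with A by the simple linear operator C described there, A = CÃ, and we obtain
the Gaussian integral determined by the positive quadratic form ⟨A, C*Δ_kCA⟩. The elimination yields also a sum of local
terms determined by the coefficient at the variable A(b₀(c)) in (QA)(c). More exactly the coefficient is a linear operator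
S(V_k^{(k)}, b₀(c)) acting on the Lie algebra 𝔤, see the formula (124) [4] for a precise definition, and we obtain the
sum of terms −log det S(V_k^{(k)}, b₀(c)). They are simple, local, gauge invariant functions of V_k^{(k)} = Ū^k_{k+1}, and
are analyzed in the same way as the perturbative expressions. We consider the Gaussian integral now. Its logarithm is
equal to a sum of an absolute constant, cancelled by the same constant from the second term in (61), and the expression»
[(63), p. 271 L36–38 / p. 272 L4–5, typed at operator level by LQB, see below]; p. 272 L6–10 (L6–7 + L8–10) «The last sum
above can be analyzed now in many ways, for example we may use the formula (3.156) [5] for the operator Δ_k and expand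
it into generalized random walks. This gives an expansion for the sum above into gauge invariant, localized expressions,
with proper exponential decay properties. These are analyzed further in the same way as the perturbative terms.»; p. 272
L10–16 «The operator under the integral has a representation similar to (C*Δ_kC)⁻¹. More exactly the operator C(C*Δ_kC +
xI)⁻¹C* is represented by the integral (3.183) [5] with the additional term −1/2x‖χ̃(QA + D̄μ(QA))‖² under the exponential
function, where χ̃ is the characteristic function of the set of bonds corresponding to variables Ã. This term determines
a non-negative, bounded and almost local operator. The integral yields the representation analogous to (3.185)» [display
p. 272 L17 «(C*Δ_kC + xI)⁻¹ = (I + D̄μ)QG̃₃(x)Q*(I + μ*D̄*)↾_{B(Λ_{k+1})}»]; p. 272 L18–25 (L18–20 + L20–25) «where G̃₃(x) is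
defined as G̃₂, but with this additional operator. The operator G̃₃(x) has the same properties as G̃₂, especially it can
be represented by a generalized random walk expansion. By the above formula this gives an expansion of the last integral
in (63) into a sum of gauge invariant, localized terms. They are again analyzed in the way described before. Now let us
notice that gathering together the first terms in the expansions (30) we obtain the expansion of (63) for the external
field U_{k+1} = 1. This is cancelled by the second term in (61), and we obtain the desired expansion.»; k = 0: p. 265
L13–16 (L13–15 + L16) «The term log Z^{(0)}(Ω₁, U₁) − log Z^{(0)}(Ω₁, 1) can be decomposed in a similar way as the
integral in (24), and we get an expression Σ_Y 𝒫₁(Y, U₁) which is identical to the expression on the right-hand side of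
(33), only the coefficients do not depend on g₀. This expansion we analyse in the general case later.»  THE CITED INPUTS,
BY NAME (rows of this module's table, §2): [5] (3.155)–(3.156) and Sect. E = row B9-SectE / B9-3155-3156
(`B9SectECov.eq_3157`, `eq_3157_flucCov`); [5] (3.183), (3.185), Thm 3.15 = rows B9-3183 / B9-3185 / B9-Thm315
(`B9Eq3183.kappaFP`, `B9Eq3185.K3183`, `B9.Thm315Printed`, `B9.Thm315FullPrinted`, `B9Thm315Decay`); [4] (124) = row
B7-124-Prop3 (`B7.Prop3Printed`, `B7Prop3GeneralLinear`).  THE LOWER HALF THIS BINDER ABBREVIATES IS KERNEL-CHECKED IN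
LQB AND IS NOT RESTATED HERE: `B10LogDet63.matrix63` / `hasSum_matrix63` / `matrix63_of_form_le` (display (63) at
operator level, with the cell's misprint record), `B10LogDet63.diff61_split` (the (61) difference, the absolute constant
cancelled), `B10LogDet63.log_gaussian_diff61` (the sentence p. 271 L33–35 for the unconstrained Gaussian integrals; the
spine re-exports `SectC.matrix63`, `SectC.log_gaussian_diff61`), `B10LogDet63.logHalfBound_of_walks` /
`logHalfBound_integral63` / `sum_Elog_eq` («Summing the expressions with the same localization X», p. 262, ⇒ the
per-domain shape `B13.LogHalfBound`), whose ONE unprinted input is typed there as the hypothesis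
`B10LogDet63.G3WalkBound` (x-uniform (23)-type walk bounds for G̃₃(x), p. 272 L18–20; pub-balaban cell GAPS G-B10-06 /
G-IF-10).  WHAT NO TREE DECLARATION TYPES and this binder takes AS CITED, at the CHART LEVEL of (27)–(30) (the level the
step consumes, «analyzed further in the same way as the perturbative terms»; the shape is seat p6's reading, field-checked
by the lead R-G7′/R-G7″): over a tower `T`, step `k`, a system `S` of localization domains (tree length `S.dj` = 𝓛), a
complex chart space `E` (the B of (27), p. 271 L2–3 «The configuration B restricted to □₁^{(k+1)} = □₁ ∩ T^{(k+1)} is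
given by the formula (27)») with an action `π` of «the global transformations R(U), U ∈ G» (p. 264 L1–2) by continuous
linear maps, scalars `ρ` (chart radius, G3D-01), `r₀` ((7)), `Cfar` (G3D-06), `C63` (amplitude), `κ` (decay rate), the
two logarithms `logZU h U` (= log Z^{(k)}(B(Λ_{k+1}), U_{k+1}); in the lane the DEFINED `J_U + log ∫ e^{−½⟨v, Q_U v⟩}`,
R-FL (ii)) and `logZ1 h` (U_{k+1} = 1), the chart configurations `Bcfg X h U` of (27) and the finite set `dom h` of the
localization domains INSIDE B(Λ_{k+1}(h)) (p. 272 L17 «↾_{B(Λ_{k+1})}»; all sizes; supplied by the consumer from the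
lattice geometry), THERE ARE localized pieces `Ψ X : E → ℂ` (of «the expression (63)» AND of the elimination terms
−log det S(V_k^{(k)}, b₀(c))) with: `expandDiff` — the DIFFERENCE (61) IS the sum over `dom h` of `Re Ψ_X` at `B(h, U)`
minus `Re Ψ_X` at `0` (the absolute constant and «the expansion of (63) for the external field U_{k+1} = 1» cancel; only
the difference is asserted, as printed); `chart` — each piece is chart-analytic in the sense of G3D-01
`ChartAnalyticityAsCited (Ψ X) ρ (C63·e^{−κ𝓛(X)})` BY NAME, at a g-FREE amplitude (p. 265 L15 «only the coefficients do
not depend on g₀»); `inv26` — «gauge invariant»: (26) p. 263 read in the chart, `Ψ X (π u b) = Ψ X b` inside the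
analyticity ball ((32) for the pieces is DERIVED in-lane from this and the detecting property of `π`, exactly as for (60),
lane rulings R-32/R-32′ — NOT a field); `far`/`far_le` — the far monomials under G3D-06 `FarTermsDecayAsCited` BY NAME
with sizes `C63·e^{−κ𝓛(X)}` and the seventh-order currency `g_k⁷(r(g_k)p(g_k))⁷` of (30).  All constants explicit,
∃-free in the reals; a construction of Bałaban's Z^{(k)} would have to supply a term of this structure (REDUCTION PATH
recorded by the lead, R-G7, not required: `expandDiff` at the lane's defined logarithms follows from `log_gaussian_diff61`
+ `matrix63` once Q_U, Q_1 are identified with C*Δ_k(U)C, C*Δ_k(1)C, leaving {`G3WalkBound`, chart analyticity of the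
resummed pieces, the far split} as residual inputs; until then G3D-07 is counted whole).  Consumer: p6
`LogZLocalization.ofCited` → leaf `Decomp35_61` (LEAF-LEDGER C7).
[cite: Balaban1985UV3, p.271 L19–35 + (63) p.272 L4–25 + p.265 L13–16; Balaban1985BackgroundPropagators, (3.156) p.428 + (3.183)–(3.185) p.432] -/
structure LogZLocalizedAsCited (T : B10.TowerRun) (k : ℕ) {S : LocDomainSys}
    (E : Type) [NormedAddCommGroup E] [NormedSpace ℂ E] {Γ : Type} (π : Γ → E →L[ℂ] E) (ρ r₀ Cfar C63 κ : ℝ)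
    (logZU : T.Hist (k + 1) → T.Cfg (k + 1) → ℝ) (logZ1 : T.Hist (k + 1) → ℝ)
    (Bcfg : S.Dom → T.Hist (k + 1) → T.Cfg (k + 1) → E) (dom : T.Hist (k + 1) → Finset S.Dom) where
  /-- the localized pieces of (63) and of the elimination terms, through the chart of (27) -/
  Ψ : S.Dom → E → ℂ
  /-- (61) localized: the difference of the two logarithms IS `Σ_{X ∈ dom h} (Re Ψ_X(B(h,U)) − Re Ψ_X(0))` — the two
  expansions share their absolute constant («cancelled by the same constant from the second term in (61)»; «the expansion
  of (63) for the external field U_{k+1} = 1 … is cancelled by the second term in (61)»); only the difference is asserted -/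
  expandDiff : ∀ h U, logZU h U - logZ1 h = ∑ X ∈ dom h, ((Ψ X (Bcfg X h U)).re - (Ψ X 0).re)
  /-- «localized expressions, with proper exponential decay properties»: G3D-01 at the g-free rate `C63·e^{−κ𝓛(X)}` -/
  chart : ∀ X, ChartAnalyticityAsCited (Ψ X) ρ (C63 * Real.exp (-(κ * S.dj X)))
  /-- «gauge invariant»: (26) for the pieces, in the chart, under the global transformations `π u` -/
  inv26 : ∀ X (u : Γ), ∀ b ∈ ball (0 : E) ρ, π u b ∈ ball (0 : E) ρ → Ψ X (π u b) = Ψ X b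
  /-- the far monomials of the pieces -/
  far : S.Dom → T.Hist (k + 1) → T.Cfg (k + 1) → ℝ
  /-- … under G3D-06 -/
  far_le : FarTermsDecayAsCited far (fun X => C63 * Real.exp (-(κ * S.dj X))) Cfar
    (T.g k ^ 7 * (B10.rFun r₀ (T.g k) * B10.pFun T.b₀ T.p₀ (T.g k)) ^ 7)

namespace LogZLocalizedAsCited

variable {T : B10.TowerRun} {k : ℕ} {S : LocDomainSys} {E : Type} [NormedAddCommGroup E] [NormedSpace ℂ E]
  {Γ : Type} {π : Γ → E →L[ℂ] E} {ρ r₀ Cfar C63 κ : ℝ}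
  {logZU : T.Hist (k + 1) → T.Cfg (k + 1) → ℝ} {logZ1 : T.Hist (k + 1) → ℝ}
  {Bcfg : S.Dom → T.Hist (k + 1) → T.Cfg (k + 1) → E} {dom : T.Hist (k + 1) → Finset S.Dom}

/-- The amplitude `C63` of G3D-07 is nonnegative as soon as there is a localization domain (it bounds `‖Ψ_X 0‖·e^{κ𝓛(X)}`).
Bookkeeping over the binder, via G3D-01 `ChartAnalyticityAsCited.bound_nonneg`. [cite: Balaban1985UV3, (25) p.262 + p.265 L15] -/
theorem amplitude_nonneg (Λ : LogZLocalizedAsCited T k E π ρ r₀ Cfar C63 κ logZU logZ1 Bcfg dom)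
    (X : S.Dom) : 0 ≤ C63 :=
  nonneg_of_mul_nonneg_left ((Λ.chart X).bound_nonneg) (Real.exp_pos _)

/-- **Each localized difference piece obeys the (25)-type bound at a g-FREE amplitude** (p. 265 L14–15 «identical to the
expression on the right-hand side of (33), only the coefficients do not depend on g₀»): for a chart configuration in the
half-ball of G3D-01 («the bound (28)»), `|Re Ψ_X(b) − Re Ψ_X(0)| ≤ 2·C63·e^{−κ𝓛(X)}`.  Kernel-checked bookkeeping over the
binder (the input of LQB `B10Eq59Localization.sum_abs_act_large_le_of_bound25` for the domains not «contained in a cube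
of the size R(g_k)M₁», p. 270). [cite: Balaban1985UV3, (25) p.262 + (59) p.270 + p.265 L13–15] -/
theorem abs_re_sub_re_le (Λ : LogZLocalizedAsCited T k E π ρ r₀ Cfar C63 κ logZU logZ1 Bcfg dom)
    (X : S.Dom) {b : E} (hb : b ∈ closedBall (0 : E) (ρ / 2)) :
    |(Λ.Ψ X b).re - (Λ.Ψ X 0).re| ≤ 2 * (C63 * Real.exp (-(κ * S.dj X))) := by
  have h0 : (0 : E) ∈ closedBall (0 : E) (ρ / 2) := mem_closedBall_self (by have := (Λ.chart X).1; positivity)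
  have h1 := (Λ.chart X).2.2 _ hb
  have h2 := (Λ.chart X).2.2 _ h0
  calc |(Λ.Ψ X b).re - (Λ.Ψ X 0).re| ≤ |(Λ.Ψ X b).re| + |(Λ.Ψ X 0).re| := abs_sub _ _
    _ ≤ ‖Λ.Ψ X b‖ + ‖Λ.Ψ X 0‖ := add_le_add (Complex.abs_re_le_norm _) (Complex.abs_re_le_norm _)
    _ ≤ 2 * (C63 * Real.exp (-(κ * S.dj X))) := by linarith

/-- **The additional term (61), bounded on the half-ball**: if every chart configuration of the history lies in the
half-ball of G3D-01 («the bound (28)» with s ≤ ρ/2), then `|log Z^{(k)}(B(Λ_{k+1}), U_{k+1}) − log Z^{(k)}(B(Λ_{k+1}), 1)| ≤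
2·C63·Σ_{X ∈ dom h} e^{−κ𝓛(X)}` — `expandDiff` summed with `abs_re_sub_re_le`.  Kernel-checked bookkeeping (the raw form
before the lane splits `dom h` into retained and large domains, p. 270 / (59)). [cite: Balaban1985UV3, (61) p.271 + (25) p.262] -/
theorem abs_diff61_le (Λ : LogZLocalizedAsCited T k E π ρ r₀ Cfar C63 κ logZU logZ1 Bcfg dom)
    (h : T.Hist (k + 1)) (U : T.Cfg (k + 1))
    (hB : ∀ X ∈ dom h, Bcfg X h U ∈ closedBall (0 : E) (ρ / 2)) :
    |logZU h U - logZ1 h| ≤ 2 * C63 * ∑ X ∈ dom h, Real.exp (-(κ * S.dj X)) := by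
  rw [Λ.expandDiff h U, Finset.mul_sum]
  refine (Finset.abs_sum_le_sum_abs _ _).trans (Finset.sum_le_sum fun X hX => ?_)
  calc |(Λ.Ψ X (Bcfg X h U)).re - (Λ.Ψ X 0).re| ≤ 2 * (C63 * Real.exp (-(κ * S.dj X))) :=
        Λ.abs_re_sub_re_le X (hB X hX)
    _ = 2 * C63 * Real.exp (-(κ * S.dj X)) := by ring

/-- Summed far monomials of the pieces over any finite set of domains: `|Σ_{X ∈ s} far X h U| ≤ Cfar·g_k⁷(r p)⁷·Σ_{X ∈ s}
C63·e^{−κ𝓛(X)}` — G3D-06 `FarTermsDecayAsCited.abs_sum_le` BY NAME. Bookkeeping. [cite: Balaban1985UV3, p.271 L6–8 + (60) p.271] -/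
theorem abs_sum_far_le (Λ : LogZLocalizedAsCited T k E π ρ r₀ Cfar C63 κ logZU logZ1 Bcfg dom)
    (s : Finset S.Dom) (h : T.Hist (k + 1)) (U : T.Cfg (k + 1)) :
    |∑ X ∈ s, Λ.far X h U|
      ≤ Cfar * (T.g k ^ 7 * (B10.rFun r₀ (T.g k) * B10.pFun T.b₀ T.p₀ (T.g k)) ^ 7)
        * ∑ X ∈ s, C63 * Real.exp (-(κ * S.dj X)) :=
  Λ.far_le.abs_sum_le s h U

end LogZLocalizedAsCited

end LogZLoc

end Gap

end Literature.MathematicalPhysics.QuantumFieldTheory.Balaban1985CMP102.Binders
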